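import Summits.ABC.ABC.Theses.DefiniteXi
import Summits.ABC.ABC.Theorems.DefiniteXiXiBoundXiDvdTwelve
import Literature.NumberTheory.Automorphic.DefiniteOrderUnitsCardDvd
import HarnessLib

/-!
# `gcd_i (w_i φ_i) ∣ 12` on an eigen-line
(stub `stub_gcdWeightMulDvdTwelve` of line `Sketch`, crux `EisensteinQuarantine`, stmt-ABC-15023)

Let `S` be a Brandt setup of type `(N⁺, N⁻)` (definite quaternion algebra over `ℚ`, Eichler order
`O`), `w_c = #O_L(I_c)ˣ / 2` the Gross weights on the class set (`Brandt.weight S.O`), and suppose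
the eigen-lattice `L(λ) ⊆ ℤ^{Cls O}` of the Brandt matrices is the line `ℤ φ`, `φ ≠ 0`. Then
`d := gcd_c (w_c φ_c)` divides `12`.

Proof.
* `φ` is primitive: the eigen-lattice is saturated, so Bezout gives `Σ_c u_c φ_c = 1`
  (`XiBoundXiDvdTwelve.exists_sum_mul_eq_one_of_eigenLine`).
* `d ∣ w_c φ_c` (`Finset.gcd_dvd`) and `w_c ∣ 12` (`Brandt.XiSetup.weight_dvd_twelve`: unit groups
  of definite `ℤ`-orders over `ℚ` have order dividing `24`), so `d ∣ 12 φ_c` for every `c`, and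
  Bezout transports this to `d ∣ 12` (`XiBoundXiDvdTwelve.dvd_of_forall_dvd_mul`).
-/

-- `Summit.<Summit>.<Problem>`: for the single-conjunct summit `ABC` the duplicate `ABC.ABC` is mandated.
set_option linter.dupNamespace false

noncomputable section

namespace Summit.ABC.ABC.Theorems

open Literature.NumberTheory.Automorphic XiBoundXiDvdTwelve

/-- **`gcd_c (w_c φ_c) ∣ 12` on an eigen-line.** In a Brandt setup `S` with Gross weights
`w = Brandt.weight S.O`, if the eigen-lattice is the line `ℤ φ` (`φ ≠ 0`) then `φ` is primitive
(saturation; `exists_sum_mul_eq_one_of_eigenLine`) and `w_c ∣ 12`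
(`Brandt.XiSetup.weight_dvd_twelve`), so `gcd_c (w_c φ_c) ∣ 12 φ_c` for all `c`, whence
`gcd_c (w_c φ_c) ∣ 12` by Bezout (`dvd_of_forall_dvd_mul`). -/
theorem stub_gcdWeightMulDvdTwelve :
    ∀ {Nplus Nminus : ℕ} (S : Brandt.XiSetup Nplus Nminus) (lam : ℕ → ℤ)
      [Fintype (Brandt.ClassSet S.O)],
      ∀ φ : Brandt.ClassSet S.O → ℤ, φ ≠ 0 →
        Brandt.eigenLattice (Nplus * Nminus) (Brandt.matrix S.O) lam = ℤ ∙ φ →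
        Finset.univ.gcd (fun i => (Brandt.weight S.O i : ℤ) * φ i) ∣ 12 := by
  intro Nplus Nminus S lam _ φ hφ hL
  obtain ⟨u, hu⟩ := exists_sum_mul_eq_one_of_eigenLine hφ hL
  refine dvd_of_forall_dvd_mul hu fun i => ?_
  -- `d ∣ w_i φ_i ∣ 12 φ_i`
  have h1 : Finset.univ.gcd (fun i => (Brandt.weight S.O i : ℤ) * φ i) ∣
      (Brandt.weight S.O i : ℤ) * φ i :=
    Finset.gcd_dvd (Finset.mem_univ i)
  have h2 : (Brandt.weight S.O i : ℤ) ∣ 12 := by exact_mod_cast S.weight_dvd_twelve i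
  exact h1.trans (mul_dvd_mul_right h2 _)

end Summit.ABC.ABC.Theorems

end
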